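import Summits.KontsevichZagierPeriods.KontsevichZagierPeriods.Theses.K2SymbolChains
import Literature.NumberTheory.Transcendental.KZLogCalculusProofs

/-!
# `FigureEightIsTwoSmyth`: reduction of the `∀`-form to one explicit pair (helper)

Item stmt-KontsevichZagierPeriods-5203 of route K2SymbolChains asserts
`KZ.Equivalent r r'` for ALL integral representations `r`, `r'` with the prescribed domains whose
integrands agree on the domain with the prescribed ones (the unfolded torus representations of
`M(A_{4₁})` and of `2·M(1+x+y)`). Since two representations with the same domain and integrands
agreeing on it differ by a relation (`KZ.of_sub_of_mem_relations_of_eqOn`, integrand additivity with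
a zero representation), the item is equivalent to the existence of ONE such pair that is
equivalent. This file records that reduction (`forall_equivalent_of_exists`, generic in the
prescribed data, and its specialisation `figureEightIsTwoSmyth_of_exists`), so that the eventual
chain (JensenMove ×5, the K₂ witness `L ∧ m = z ∧ (1−z) + w ∧ (1−w)` on the gluing variety
`z(1−z)w(1−w) = 1`, SteinbergChain ×5; see the item's evidence file) may be built between two
CHOSEN representations, e.g. `KZ.logUnfoldRep`s.
-/

-- single-conjunct summit: Sub = Summit, so the namespace segment repeats by design (CONVENTIONS §2)
set_option linter.dupNamespace false

namespace Summit.KontsevichZagierPeriods.KontsevichZagierPeriods.Theorems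

open Set Literature.NumberTheory.Transcendental

/-- Generic reduction: if one pair `(r₀, r₀')` with domains `D`, `D'` and integrands agreeing with
`f`, `f'` on them is KZ-equivalent, then every such pair is (congruence
`KZ.of_sub_of_mem_relations_of_eqOn` on both sides and transitivity).
[Kontsevich–Zagier 2001, §1.2, rule 1)] [folklore] -/
theorem forall_equivalent_of_exists {n m : ℕ} {D : Set (Fin n → ℝ)} {f : (Fin n → ℝ) → ℝ}
    {D' : Set (Fin m → ℝ)} {f' : (Fin m → ℝ) → ℝ}
    (h : ∃ (r₀ : KZ.IntegralRep n) (r₀' : KZ.IntegralRep m), r₀.domain = D ∧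
      EqOn r₀.integrand f r₀.domain ∧ r₀'.domain = D' ∧ EqOn r₀'.integrand f' r₀'.domain ∧
      KZ.Equivalent r₀ r₀')
    (r : KZ.IntegralRep n) (r' : KZ.IntegralRep m) (hr : r.domain = D)
    (hf : EqOn r.integrand f r.domain) (hr' : r'.domain = D') (hf' : EqOn r'.integrand f' r'.domain) :
    KZ.Equivalent r r' := by
  obtain ⟨r₀, r₀', h₀d, h₀f, h₀d', h₀f', he⟩ := h
  have h1 : KZ.of r - KZ.of r₀ ∈ KZ.relations :=
    KZ.of_sub_of_mem_relations_of_eqOn (by rw [h₀d, hr]) fun x hx => by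
      rw [hf hx, h₀f (show x ∈ r₀.domain by rw [h₀d, ← hr]; exact hx)]
  have h2 : KZ.of r₀' - KZ.of r' ∈ KZ.relations :=
    KZ.of_sub_of_mem_relations_of_eqOn (by rw [h₀d', hr']) fun x hx => by
      rw [h₀f' hx, hf' (show x ∈ r'.domain by rw [hr', ← h₀d']; exact hx)]
  have : KZ.of r - KZ.of r' =
      (KZ.of r - KZ.of r₀) + (KZ.of r₀ - KZ.of r₀') + (KZ.of r₀' - KZ.of r') := by abel
  show KZ.of r - KZ.of r' ∈ KZ.relations
  rw [this]
  exact KZ.relations.add_mem (KZ.relations.add_mem h1 he) h2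

/-- Reduction of item `FigureEightIsTwoSmyth` (stmt-KontsevichZagierPeriods-5203) to ONE pair: if
some representations `r₀`, `r₀'` with the item's domains (unfolded torus representations of
`M(A_{4₁})`, `A = M⁴+M⁻⁴−M²−M⁻²−2−L−L⁻¹`, and of `2·M(1+x+y)`) and integrands agreeing with the
item's on those domains are KZ-equivalent, then the item holds. [folklore] -/
theorem figureEightIsTwoSmyth_of_exists
    (h : ∃ (r₀ r₀' : KZ.IntegralRep 3),
      r₀.domain = {w | (1 < w 2 ∧ w 2 < (16 * ((1 - w 0 ^ 2) / (1 + w 0 ^ 2)) ^ 4 -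
        20 * ((1 - w 0 ^ 2) / (1 + w 0 ^ 2)) ^ 2 + 2 - 2 * (1 - w 1 ^ 2) / (1 + w 1 ^ 2)) ^ 2) ∨
        ((16 * ((1 - w 0 ^ 2) / (1 + w 0 ^ 2)) ^ 4 - 20 * ((1 - w 0 ^ 2) / (1 + w 0 ^ 2)) ^ 2 + 2 -
        2 * (1 - w 1 ^ 2) / (1 + w 1 ^ 2)) ^ 2 < w 2 ∧ w 2 < 1)} ∧
      EqOn r₀.integrand (fun w => (if 1 < w 2 then (1:ℝ) else -1) * 2 /
        ((1 + w 0 ^ 2) * (1 + w 1 ^ 2) * w 2)) r₀.domain ∧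
      r₀'.domain = {w | (1 < w 2 ∧ w 2 < ((1 + (1 - w 0 ^ 2) / (1 + w 0 ^ 2) +
        (1 - w 1 ^ 2) / (1 + w 1 ^ 2)) ^ 2 + (2 * w 0 / (1 + w 0 ^ 2) + 2 * w 1 / (1 + w 1 ^ 2)) ^ 2)) ∨
        (((1 + (1 - w 0 ^ 2) / (1 + w 0 ^ 2) + (1 - w 1 ^ 2) / (1 + w 1 ^ 2)) ^ 2 +
        (2 * w 0 / (1 + w 0 ^ 2) + 2 * w 1 / (1 + w 1 ^ 2)) ^ 2) < w 2 ∧ w 2 < 1)} ∧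
      EqOn r₀'.integrand (fun w => (if 1 < w 2 then (1:ℝ) else -1) * 4 /
        ((1 + w 0 ^ 2) * (1 + w 1 ^ 2) * w 2)) r₀'.domain ∧
      KZ.Equivalent r₀ r₀') :
    Theses.K2SymbolChains.FigureEightIsTwoSmyth := by
  unfold Theses.K2SymbolChains.FigureEightIsTwoSmyth
  intro r r' hr hf hr' hf'
  exact forall_equivalent_of_exists h r r' hr hf hr' hf'

end Summit.KontsevichZagierPeriods.KontsevichZagierPeriods.Theorems
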